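import Summits.BirchSwinnertonDyer.BirchSwinnertonDyer.Theses.RamifiedHeegnerPair
import Summits.BirchSwinnertonDyer.Rank1Residual.Additive.KatoDescentRankOnePerrinRiou
import Summits.BirchSwinnertonDyer.Rank1Residual.Additive.KMCTrivialDescentRankOne
import Summits.BirchSwinnertonDyer.Rank1Residual.Additive.KatoDescentClosedBindersContra
import Literature.NumberTheory.EllipticCurves.Kato2004.PerrinRiouRatio
import HarnessLib

/-!
# Line `katoprhalf` for crux U₁ = `RamifiedHeegnerPair.LeafRankOneUpperAtThree` (stmt-26022):
# the HEIGHT-FREE Kato–Perrin-Riou descent read as an INEQUALITY at the additive prime 3.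

Registered skeleton of line `katoprhalf` (crux-ideate seat 2, round 1; card `Lines/katoprhalf.md`, idea `Ideas/katoprhalf.md`). Nothing is asserted; `sorry` only inside `stub_*`; BSD is proved for no curve.
-/

set_option autoImplicit false
set_option linter.dupNamespace false

noncomputable section

open scoped Classical

open WeierstrassCurve Literature.NumberTheory.EllipticCurves
  Literature.NumberTheory.EllipticCurves.Rank1Residual
  Literature.NumberTheory.EllipticCurves.Rank1Residual.Typed
  Literature.NumberTheory.EllipticCurves.IwasawaAlgebra
  Summit.BirchSwinnertonDyer.Rank1Residual.Additive

namespace Summit.BirchSwinnertonDyer.BirchSwinnertonDyer.Cruxes.LeafRankOneUpperAtThree.Katoprhalf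

section Interface

variable (PRRatio : ∀ (W : WeierstrassCurve ℚ) [W.IsElliptic] [W.IsGloballyMinimal] (p : ℕ)
  [Fact p.Prime], ℚ_[p] → Prop)

/-- **PR^{≤} — the UPPER HALF of Perrin-Riou's conjecture up to a `p`-adic unit** (valuation currency):
in analytic rank one Kato's zeta element has a Perrin-Riou ratio `ℒ ≠ 0` with
`v_p(ℒ) ≤ ord_p( L′(W,1) / (Ω_W · Reg W) )` — "the bottom layer of Kato's zeta element is AT MOST as
`p`-divisible in `H¹(ℤ[1/p],T) ≅ ℤ_p` as Perrin-Riou's formula predicts". One half of the tree's node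
`PerrinRiouUpToUnitAt PRRatio W p` (Burns–Kurihara–Sano Conj. 2.8 (ii) / Perrin-Riou 1993 §3.3). -/
def PerrinRiouUpperHalfAt (W : WeierstrassCurve ℚ) [W.IsElliptic] [W.IsGloballyMinimal] (p : ℕ)
    [Fact p.Prime] : Prop :=
  W.analyticRank = 1 →
    ∃ ℒ : ℚ_[p], PRRatio W p ℒ ∧ ℒ ≠ 0 ∧
      ∃ q : ℚ, W.leadingLCoeff / ((W.realPeriodRat : ℂ) * (W.regulator : ℂ)) = (q : ℂ) ∧
        ℒ.valuation ≤ padicValRat p q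

variable {PRRatio}
variable {IsOf : ∀ (W : WeierstrassCurve ℚ) [W.IsElliptic] [W.IsGloballyMinimal] (p : ℕ) [Fact p.Prime],
  KatoDescentDatum p → Prop}

/-- The full node PR^× implies its upper half (sanity). -/
theorem perrinRiouUpperHalfAt_of_upToUnit (W : WeierstrassCurve ℚ) [W.IsElliptic] [W.IsGloballyMinimal]
    (p : ℕ) [Fact p.Prime] (h : PerrinRiouUpToUnitAt PRRatio W p) : PerrinRiouUpperHalfAt PRRatio W p := by
  intro hr
  obtain ⟨ℒ, hℒ, hne, q, hq, hv⟩ := h hr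
  exact ⟨ℒ, hℒ, hne, q, hq, hv.le⟩

/-- **FIRST LEMMA (kernel glue, sorry-free): in analytic rank one at an odd additive potentially good
prime with (12.5.2), the UPPER half `ord_p #Ш ≤ ord_p #Ш_an` follows from Kato's divisibility
(Reading 2), realizability (Reading 3), the PRINTED rank-one count through `ℒ` (Reading 1″) and the
UPPER HALF of Perrin-Riou's conjecture — NO main conjecture, NO `p`-adic height, NO signed objects.**
From `[H¹:z] = p^m·#H²` (Thm. 14.5 (3), `m ≥ 0`) the count reads `v_p ℒ = m + ord_p#Ш + ord_p Tam`,
so `ord_p #Ш ≤ v_p ℒ − ord_p Tam ≤ ord_p(L′/(Ω·Reg)) − ord_p Tam = ord_p #Ш_an`. -/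
theorem missingUpperBoundAt_of_perrinRiouUpperHalf (hC : RankOneCountReading IsOf PRRatio)
    (hdiv : DivisibilityReading IsOf) (hreal : Realizable IsOf)
    (hGZK : rank_eq_analyticRank_of_analyticRank_le_one) (hmod : hasEntireLFunction_rat)
    (W : WeierstrassCurve ℚ) [W.IsElliptic] [W.IsGloballyMinimal] (p : ℕ) [Fact p.Prime]
    (hr : W.analyticRank = 1) (hp : p ≠ 2) (hadd : Addv W p) (hj : 0 ≤ padicValRat p W.j)
    (hK : Kato2004.ImageContainsSL2 W p) (hPR : PerrinRiouUpperHalfAt PRRatio W p) :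
    MissingUpperBoundAt W p := by
  have hfin : Finite W.sha := (hGZK W (by rw [hr])).2
  obtain ⟨D, hDof⟩ := hreal W p hp hadd hj hK
  obtain ⟨ℒ, hℒ, hne, q, hq, hle⟩ := hPR hr
  obtain ⟨hfinH2, hiff, hcount⟩ := hC W p D ℒ hr hp hadd hj hK hfin hDof hℒ
  have hz : D.zetaIndex ≠ 0 := hiff.mp hne
  obtain ⟨m, hm⟩ := D.exists_zetaIndex_eq_pow_mul hfinH2 (hdiv W p D hp hadd hj hK hDof) hz
  have hval := hcount m hm
  obtain ⟨q', hq', hv'⟩ := exists_shaAn_eq_of_leadingTerm_eq W p (irr_of_imageContainsSL2 W p hK)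
    (W.leadingLCoeff_ne_zero_holds (hmod W)) hq
  refine ⟨q', hq', ?_⟩
  have hsha : padicValNat p (Nat.card (AddCommGroup.primaryComponent W.sha p)) =
      padicValNat p W.shaOrder := by
    unfold WeierstrassCurve.shaOrder
    exact padicValNat_card_addPrimaryComponent p
  rw [hv', ← hsha]
  have hm0 : (0 : ℤ) ≤ (m : ℤ) := Int.natCast_nonneg m
  linarith

end Interface

/-! ## The line: the four stub STATEMENTS (named), the stubs, and the composition concluding the crux BY NAME -/

/-- Statement of stub 1 (print inputs): Gross–Zagier–Kolyvagin in analytic rank ≤ 1 (the route's own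
item `PublishedInputGZK`) and the entireness of `L(E,s)` (modularity). Published theorems. -/
def PrintInputs : Prop :=
  rank_eq_analyticRank_of_analyticRank_le_one ∧ hasEntireLFunction_rat

/-- Statement of stub 2 (print-shape Kato readings at the print-exact closed binders
`IsKatoZetaDescentDatumOfContra`, `Kato2004.PRRatio`): realizability of a Kato descent datum (Kato
Thm. 12.4, 12.5 (4), §14.14), Kato's divisibility Thm. 12.5 (4) on it, and the rank-one Poitou–Tate
count through the Perrin-Riou ratio (Kato (14.9.3)/§14.14 + Coates' exact annihilators;
Burns–Kurihara–Sano Thm. 7.3 / 7.8 (d) shape) — cell bsd-potss Readings 3, 2, 1″ (memo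
KMC-DESCENT-MEMO v2 §4, R1-a…f, referee PASS at paper level). -/
def KatoReadingsAtThreeContra : Prop :=
  Realizable IsKatoZetaDescentDatumOfContra ∧ DivisibilityReading IsKatoZetaDescentDatumOfContra ∧
    RankOneCountReading IsKatoZetaDescentDatumOfContra Kato2004.PRRatio

/-- Statement of stub 3 (THE CONJECTURE-GRADE STEP, load-bearing): the UPPER HALF of Perrin-Riou's
conjecture at the additive prime `3` on the Gss2 leaf rows whose `3`-adic image contains `SL₂(ℤ₃)` —
Kato's zeta element of `E = V₀ ⊗ χ₋₃` is not more `3`-divisible than `(L′(E,1)/(Ω·Reg))·log_ω(x)·x`.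
In print: conjecture at every `p` (Perrin-Riou 1993 §3.3; Burns–Kurihara–Sano Conj. 2.8 (ii));
theorem for `p ∤ 2N` (Burungale–Skinner–Tian–Wan 2024 Thm. 1.13 / 6.4, Cor. 6.5); open at additive
`p`. Intended attack: untwist to the ω-branch of the good supersingular `V₀` at `3` (line card). -/
def PerrinRiouUpperHalfOnSL2LeafRows : Prop :=
  ∀ (W : WeierstrassCurve ℚ) [W.IsElliptic] [W.IsGloballyMinimal],
    ¬ W.HasCM → Addv W 3 → SubGss W 3 → Kato2004.ImageContainsSL2 W 3 →
      PerrinRiouUpperHalfAt Kato2004.PRRatio W 3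

/-- Statement of stub 4 (residual rows, a DIFFERENT obstruction): the upper half on the Gss2 leaf
rows whose `3`-adic image does NOT contain `SL₂(ℤ₃)` (mod-`3` image `C_ns(3)` or its normaliser, or
Elkies' mod-`9` defect; `E[3]` is irreducible on the whole leaf since `V₀` is supersingular at `3`).
Intended mechanism: the image-free Kato readings (Thm. 12.4 (3), 12.5 (3)) give the same inequality
up to the defect `μ(𝐇²(T₃E)⁰)`, which vanishes under Coates–Sujatha's Conjecture A / Iwasawa's
`μ = 0` for `ℚ(E[3])` (tree pattern `Irreducible.missingUpperBoundAt_of_h2MuZero`, rank 0; item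
19189 `WildUpperNonsurjTower` of the O6 lane has the same shape). -/
def UpperHalfOnNonSL2LeafRows : Prop :=
  ∀ (W : WeierstrassCurve ℚ) [W.IsElliptic] [W.IsGloballyMinimal],
    ¬ W.HasCM → Addv W 3 → SubGss W 3 → ¬ Kato2004.ImageContainsSL2 W 3 →
      W.analyticRank = 1 → MissingUpperBoundAt W 3

/-- stub 1 — print inputs (GZK ∧ modularity). -/
theorem stub_printInputs : PrintInputs := by
  sorry

/-- stub 2 — the three print-shape Kato readings at the closed binders. -/
theorem stub_katoReadings : KatoReadingsAtThreeContra := by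
  sorry

/-- stub 3 — PR^{≤} at additive 3 on the SL₂-rows of the leaf (load-bearing, conjecture-grade). -/
theorem stub_perrinRiouUpperHalf_sl2Rows : PerrinRiouUpperHalfOnSL2LeafRows := by
  sorry

/-- stub 4 — the non-SL₂ leaf rows (μ-defect rows). -/
theorem stub_upper_nonSL2Rows : UpperHalfOnNonSL2LeafRows := by
  sorry

/-! ### Name-keyed aliases of the stub statements (tree pattern of
`SmoothPoincare4/…/Lines/entropy-ratchet.lean`): `Registered.stub_X` is `X`'s statement under the
registered stub's short name, so the native skeleton audit reads the composition's hypotheses as the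
registered stubs (the `@[stub]` tag being gate-reserved). -/
namespace Registered

/-- alias: statement of `stub_printInputs`. -/
abbrev stub_printInputs : Prop := PrintInputs
/-- alias: statement of `stub_katoReadings`. -/
abbrev stub_katoReadings : Prop := KatoReadingsAtThreeContra
/-- alias: statement of `stub_perrinRiouUpperHalf_sl2Rows`. -/
abbrev stub_perrinRiouUpperHalf_sl2Rows : Prop := PerrinRiouUpperHalfOnSL2LeafRows
/-- alias: statement of `stub_upper_nonSL2Rows`. -/
abbrev stub_upper_nonSL2Rows : Prop := UpperHalfOnNonSL2LeafRows

end Registered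

/-- consistency: each stub proves its name-keyed alias (definitional). -/
example : Registered.stub_printInputs ∧ Registered.stub_katoReadings ∧
    Registered.stub_perrinRiouUpperHalf_sl2Rows ∧ Registered.stub_upper_nonSL2Rows :=
  ⟨stub_printInputs, stub_katoReadings, stub_perrinRiouUpperHalf_sl2Rows, stub_upper_nonSL2Rows⟩

/-- **Composition: the four registered stub statements give the crux U₁ BY NAME** (kernel-checked;
the only mathematics is `missingUpperBoundAt_of_perrinRiouUpperHalf` and `SubGss ⇒ ¬PotMult`). -/
theorem LeafRankOneUpperAtThree_of (h₁ : Registered.stub_printInputs)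
    (h₂ : Registered.stub_katoReadings) (h₃ : Registered.stub_perrinRiouUpperHalf_sl2Rows)
    (h₄ : Registered.stub_upper_nonSL2Rows) :
    Summit.BirchSwinnertonDyer.BirchSwinnertonDyer.Theses.RamifiedHeegnerPair.LeafRankOneUpperAtThree := by
  obtain ⟨hGZK, hmod⟩ := h₁
  obtain ⟨hreal, hdiv, hC⟩ := h₂
  intro W _ _ hCM hadd hG hr
  by_cases hK : Kato2004.ImageContainsSL2 W 3
  · have hj : 0 ≤ padicValRat 3 W.j := not_lt.mp hG.1.1
    exact missingUpperBoundAt_of_perrinRiouUpperHalf hC hdiv hreal hGZK hmod W 3 hr (by decide) hadd hj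
      hK (h₃ W hCM hadd hG hK)
  · exact h₄ W hCM hadd hG hK hr

/-- The crux from the registered stubs. -/
theorem LeafRankOneUpperAtThree_of_stubs :
    Summit.BirchSwinnertonDyer.BirchSwinnertonDyer.Theses.RamifiedHeegnerPair.LeafRankOneUpperAtThree :=
  LeafRankOneUpperAtThree_of stub_printInputs stub_katoReadings stub_perrinRiouUpperHalf_sl2Rows
    stub_upper_nonSL2Rows

end Summit.BirchSwinnertonDyer.BirchSwinnertonDyer.Cruxes.LeafRankOneUpperAtThree.Katoprhalf

end
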